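import Mathlib
import Literature.Computability.AlgebraicComplexity.NestFreeMatchingPoly
import Literature.Computability.AlgebraicComplexity.MonotoneCircuitNewtonPolytopeXC
import Literature.Algebra.Polynomial.NewtonPolytope
import Literature.Barriers.PneNP.TSPExtensionComplexity
import Literature.Barriers.PneNP.TSPExtensionComplexityFaces
import Literature.Barriers.PneNP.ExtendedFormulationLinearImage
import Literature.Combinatorics.Optimization.CorrelationPolytopeGridMinor
import Literature.Barriers.PneNP.CorrelationPolytopeXCLowerBoundGraph
import Summits.ValiantsHypothesis.ValiantsHypothesis.Theses.FifoMatching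
import Summits.ValiantsHypothesis.ValiantsHypothesis.Theorems.FifoMatchingXcMinkowskiMultiplesHard
import Summits.ValiantsHypothesis.ValiantsHypothesis.Theorems.FifoMatchingNNMonomialCofactorHard
import Summits.ValiantsHypothesis.ValiantsHypothesis.Theorems.FifoMatchingNFPolytopeQuasiPolyXCHolds
import Literature.Analysis.Convex.LinearProgrammingDuality
import HarnessLib

/-!
# Sketch — crux ideas on stmt-ValiantsHypothesis-21181 `FifoMatching.NNDivisionHard` (val-idea-43 g0, lens (f) harvest)

§A  `virtual-xc` : ONE DIVISION = ONE VIRTUAL EXTENDED FORMULATION.  The route decl keeps BOTH `L₊(NN_n·h)` and `L₊(h)`;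
    by Hrubeš–Yehudayoff Thm 35 (tree: `hasEFOfSize_newtonPolytope_complexity`) and `Newt(NN_n·h) = NFP_n + Newt(h)` the pair
    (R, Q) := (NFP_n + Newt h, Newt h) is a VIRTUAL extended formulation of NFP_n = R − Q of total size ≤ 3·(L₊(NN·h)+L₊(h))
    (Hertrich–Loho 2024/25, arXiv:2411.03006 §4).  Hence the polytope-side statement 21181 needs is VXC-hardness
    (`VxcMinkowskiHard`), strictly weaker than XC-MINKOWSKI (`vxcMinkowskiHard_of_xcMinkowski`), and it still gives 21181 BY NAME
    (`nnDivisionHard_of_vxcMinkowski`, PROVED below).  n-free form on the correlation polytope: `VxcCorHard`.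
§B  `devirtualize` : CONDITIONAL bridge on a NEGATIVE answer to Hertrich–Loho Question 5.1 in quasi-polynomial form (`DeVirt k`),
    plus the unconditional decision-rule de-virtualization (`AffineDeVirt`: two-stage adjustable robust counterpart ⇒ honest EF).

Nothing here is claimed as a theorem of the tree except the two short proofs; 21181, COR-MINKOWSKI, VXC-COR are OPEN; VP ≠ VNP is NOT proved.
-/

set_option autoImplicit false
set_option linter.dupNamespace false

namespace Summit.ValiantsHypothesis.ValiantsHypothesis.Cruxes.NNDivisionHard.VirtualXc

open scoped NNReal Pointwise
open Matrix MvPolynomial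
open Literature.Computability.AlgebraicComplexity (complexity nestFreeMatchingPoly)
open Literature.Computability.AlgebraicComplexity.MonotoneCircuitEF (hasEFOfSize_newtonPolytope_complexity)
open Literature.Algebra.Polynomial.NewtonPolytope (newtonPolytope newtonPolytope_mul)
open Literature.Barriers.PneNP (HasEFOfSize ExtendedFormulation)
open Literature.Combinatorics.Optimization (corPolytopeGraph)
open Summit.ValiantsHypothesis.ValiantsHypothesis.Theorems.FifoMatching.XcDivision
  (hasEFOfSize_minkowski_of_multiple)

/-! ## §A  virtual extension complexity is the exact shadow of one division -/

/-- `NFP_n` as a real Newton polytope (the form used by `XcDivision.*`). -/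
noncomputable abbrev nfp (n : ℕ) : Set ((Fin (2 * n) × Fin (2 * n)) → ℝ) :=
  newtonPolytope (MvPolynomial.map NNReal.toRealHom (nestFreeMatchingPoly n ℝ≥0))

/-- The Newton passenger `Newt(h)` of a cofactor `h` over `ℝ≥0`, as a real polytope. -/
noncomputable abbrev newt {n : ℕ} (h : MvPolynomial (Fin (2 * n) × Fin (2 * n)) ℝ≥0) :
    Set ((Fin (2 * n) × Fin (2 * n)) → ℝ) :=
  newtonPolytope (MvPolynomial.map NNReal.toRealHom h)

/-- **VXC-MINKOWSKI** (virtual-xc hardness of `NFP_n` against Newton passengers, route rate): for every `c`, eventually in `n`,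
no nonzero cofactor `h` admits a PAIR of extended formulations — one of `NFP_n + Newt(h)` of size `3a`, one of `Newt(h)` of size `3b` —
with `a + b ≤ 2^((log₂ n + c)^c)`.  Weaker than XC-MINKOWSKI (which forbids the first EF alone). OPEN. -/
def VxcMinkowskiHard : Prop :=
  ∀ c : ℕ, ∃ n₀ : ℕ, ∀ n ≥ n₀, ∀ h : MvPolynomial (Fin (2 * n) × Fin (2 * n)) ℝ≥0, h ≠ 0 →
    ∀ a b : ℕ, a + b ≤ 2 ^ ((Nat.log 2 n + c) ^ c) →
      HasEFOfSize (nfp n + newt h) (3 * a) → HasEFOfSize (newt h) (3 * b) → False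

/-- ★ GLUE (proved): **VXC-MINKOWSKI ⇒ stmt-21181 `NNDivisionHard` BY NAME.**  Both summands of the route decl are charged:
`L₊(NN_n·h) ↦` an EF of `NFP_n + Newt(h)` (`XcDivision.hasEFOfSize_minkowski_of_multiple`), `L₊(h) ↦` an EF of `Newt(h)`
(`hasEFOfSize_newtonPolytope_complexity`). -/
theorem nnDivisionHard_of_vxcMinkowski (hV : VxcMinkowskiHard) :
    Summit.ValiantsHypothesis.ValiantsHypothesis.Theses.FifoMatching.NNDivisionHard := by
  intro c
  obtain ⟨n₀, hn₀⟩ := hV c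
  refine ⟨n₀, fun n hn h hh => ?_⟩
  have key : 2 ^ ((Nat.log 2 n + c) ^ c) < complexity (nestFreeMatchingPoly n ℝ≥0 * h) + complexity h := by
    by_contra hle
    push Not at hle
    exact hn₀ n hn h hh (complexity (nestFreeMatchingPoly n ℝ≥0 * h)) (complexity h) hle
      (hasEFOfSize_minkowski_of_multiple n h) (hasEFOfSize_newtonPolytope_complexity h)
  exact key

/-- VXC-MINKOWSKI is (at most as strong as, i.e.) implied by XC-MINKOWSKI — the hypothesis of
`XcDivision.nnDivisionHard_of_xcMinkowski`, verbatim. -/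
theorem vxcMinkowskiHard_of_xcMinkowski
    (hX : ∀ c : ℕ, ∃ n₀ : ℕ, ∀ n ≥ n₀, ∀ h : MvPolynomial (Fin (2 * n) × Fin (2 * n)) ℝ≥0, h ≠ 0 →
      ¬ HasEFOfSize (newtonPolytope (MvPolynomial.map NNReal.toRealHom (nestFreeMatchingPoly n ℝ≥0)) +
          newtonPolytope (MvPolynomial.map NNReal.toRealHom h)) (3 * 2 ^ ((Nat.log 2 n + c) ^ c))) :
    VxcMinkowskiHard := by
  intro c
  obtain ⟨n₀, hn₀⟩ := hX c
  refine ⟨n₀, fun n hn h hh a b hab hR _hQ => ?_⟩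
  exact hn₀ n hn h hh (hR.of_le (by omega))

/-- **VXC-COR** (n-free law, route rate): every passenger `Q = conv(q₀,…,q_K)` makes the PAIR (COR(K_n) + Q, Q) expensive:
`xc(COR(K_n) + Q) + xc(Q) > 2^((log₂ n + c)^c)` eventually.  Strictly weaker than COR-MINKOWSKI «xc(COR(K_n)+Q) alone is large».
For RATIONAL poly-bit passengers its failure puts max-cut in P/poly (value = LP₁ − LP₂, Hertrich–Loho Thm 4.6). OPEN. -/
def VxcCorHard : Prop :=
  ∀ c : ℕ, ∃ n₀ : ℕ, ∀ n ≥ n₀, ∀ (K : ℕ) (q : Fin (K + 1) → (Fin n × Fin n → ℝ)) (r s : ℕ),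
    HasEFOfSize (corPolytopeGraph (⊤ : SimpleGraph (Fin n)) + convexHull ℝ (Set.range q)) r →
    HasEFOfSize (convexHull ℝ (Set.range q)) s → 2 ^ ((Nat.log 2 n + c) ^ c) < r + s

/-- The LATTICE-passenger form actually needed downstream (Newton passengers are lattice polytopes). OPEN. -/
def VxcCorLatticeHard : Prop :=
  ∀ c : ℕ, ∃ n₀ : ℕ, ∀ n ≥ n₀, ∀ (K : ℕ) (q : Fin (K + 1) → (Fin n × Fin n → ℤ)) (r s : ℕ),
    HasEFOfSize (corPolytopeGraph (⊤ : SimpleGraph (Fin n)) +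
        convexHull ℝ (Set.range fun k i => (q k i : ℝ))) r →
    HasEFOfSize (convexHull ℝ (Set.range fun k i => (q k i : ℝ))) s → 2 ^ ((Nat.log 2 n + c) ^ c) < r + s

/-- TRANSPORT (to be proved along the tree's located-face chain K1: faces of a Minkowski sum are sums of faces — Hertrich–Loho
Lemma 4.4 / Grünbaum — and linear images commute with `+`, so the PAIR (R, Q) descends to (π F_c R, π F_c Q) with both sizes
non-increasing): VXC-COR on lattice passengers ⇒ VXC-MINKOWSKI. -/
def VxcTransport : Prop := VxcCorLatticeHard → VxcMinkowskiHard

/-! ## §B  de-virtualization (Hertrich–Loho Question 5.1, negative answer in quasi-polynomial form) -/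

/-- **DeVirt k** — «an honest EF is at most quasi-polynomially larger than a virtual one»: for all V-polytopes `P = conv S`,
`Q = conv T` (`S, T` finite nonempty) in any `ℝ^ι`: `xc(P+Q) ≤ r ∧ xc(Q) ≤ s ∧ xc(P) > t ⇒ t < 2^((log₂(r+s)+k)^k)`.  A NEGATIVE answer to
Hertrich–Loho Q5.1 («can vxc(P) be much smaller than xc(P)?») in the quantitative form they say would suffice for NN lower bounds.
CONDITIONAL input only; no evidence either way in print (HL24 p.16). -/
def DeVirt (k : ℕ) : Prop :=
  ∀ (ι : Type) [Fintype ι] (S T : Set (ι → ℝ)), S.Finite → S.Nonempty → T.Finite → T.Nonempty → ∀ r s t : ℕ,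
    HasEFOfSize (convexHull ℝ S + convexHull ℝ T) r →
    HasEFOfSize (convexHull ℝ T) s →
    ¬ HasEFOfSize (convexHull ℝ S) t → t < 2 ^ ((Nat.log 2 (r + s) + k) ^ k)

/-- CONDITIONAL GLUE of card `devirtualize` (routine from the tree's PROVED `QueueGridFace.nfPolytopeQuasiPolyXC_holds` and
threshold arithmetic `((log₂ n + c)^c + k + 2)^k ≤ (log₂ n + c')^{c'}`): de-virtualization ⇒ VXC-MINKOWSKI (⇒ 21181). -/
def DeVirtGlue : Prop :=
  ∀ k : ℕ, DeVirt k → Summit.ValiantsHypothesis.ValiantsHypothesis.Theses.FifoMatching.NFPolytopeQuasiPolyXC →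
    VxcMinkowskiHard

/-- An **affine decision rule** for the containment `x + Q ⊆ R` against given slack-form EFs `RR` (of `R`, size `r`) and `QQ`
(of `Q`, size `s`): the `R`-lift of `x + u` may be chosen AFFINE in the passenger point `u ∈ Q`
(Ben-Tal–Goryashko–Guslitzer–Nemirovski 2004 «affinely adjustable robust counterpart»). -/
def HasAffineRule {ι : Type} [Fintype ι] {r s : ℕ} (RR : ExtendedFormulation ι r) (QQ : ExtendedFormulation ι s)
    (x : ι → ℝ) : Prop :=
  ∃ (y₀ : Fin r → ℝ) (Y : Matrix (Fin r) ι ℝ),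
    ∀ u ∈ QQ.projSet, (∀ j, 0 ≤ (y₀ + Y *ᵥ u) j) ∧ RR.E *ᵥ (x + u) + RR.F *ᵥ (y₀ + Y *ᵥ u) = RR.g

/-- **AffineDeVirt** (first lemma of card `devirtualize`; provable by LP duality over `QQ`, no new mathematics): if every point of a
closed convex `P` with `P + Q = R` admits an affine decision rule against (`RR`, `QQ`), then `P` itself has an HONEST extended
formulation of size `r·(s+1)` — the virtual pair is de-virtualized at multiplicative cost.  (K-piecewise-affine rules: `K·r·(s+1)`.) -/
def AffineDeVirt : Prop :=
  ∀ (ι : Type) [Fintype ι] (r s : ℕ) (RR : ExtendedFormulation ι r) (QQ : ExtendedFormulation ι s) (P : Set (ι → ℝ)),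
    Convex ℝ P → IsClosed P → QQ.projSet.Nonempty → Bornology.IsBounded QQ.projSet →
    RR.projSet = P + QQ.projSet → (∀ x ∈ P, HasAffineRule RR QQ x) → HasEFOfSize P (r * (s + 1))

/-! ## §C  the conditional bridge, kernel-checked: `DeVirt k ⇒ VXC-MINKOWSKI ⇒ 21181` -/

/-- threshold arithmetic for the bridge: with `A = (L+c)^c`, `L ≥ 1` and `m ≤ 3·2^A`,
`(log₂ m + k)^k ≤ (L + c')^{c'}` for `c' = (c+1)·k + c + k + 1`. [folklore] -/
theorem deVirt_threshold (c k L m : ℕ) (hL : 1 ≤ L) (hm : m ≤ 3 * 2 ^ ((L + c) ^ c)) :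
    (Nat.log 2 m + k) ^ k ≤ (L + ((c + 1) * k + c + k + 1)) ^ ((c + 1) * k + c + k + 1) := by
  set A := (L + c) ^ c with hA
  have hA1 : 1 ≤ A := Nat.one_le_pow _ _ (by omega)
  -- log₂ m ≤ A + 1
  have hlog : Nat.log 2 m ≤ A + 1 := by
    have hm' : m < 2 ^ (A + 2) := by
      calc m ≤ 3 * 2 ^ A := hm
        _ < 4 * 2 ^ A := by have := Nat.two_pow_pos A; omega
        _ = 2 ^ (A + 2) := by ring
    have := Nat.log_lt_of_lt_pow' (by omega : A + 2 ≠ 0) hm'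
    omega
  -- A + 1 + k ≤ (L + c + k + 1)^(c+1)
  have hstep : A + 1 + k ≤ (L + c + k + 1) ^ (c + 1) := by
    have h1 : A ≤ (L + c + k + 1) ^ c := by
      rw [hA]; exact Nat.pow_le_pow_left (by omega) c
    have h2 : (L + c + k + 1) ^ (c + 1) = (L + c + k + 1) ^ c * (L + c + k + 1) := pow_succ _ _
    rw [h2]
    have h3 : 1 ≤ (L + c + k + 1) ^ c := Nat.one_le_pow _ _ (by omega)
    nlinarith
  calc (Nat.log 2 m + k) ^ k ≤ (A + 1 + k) ^ k := Nat.pow_le_pow_left (by omega) k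
    _ ≤ ((L + c + k + 1) ^ (c + 1)) ^ k := Nat.pow_le_pow_left hstep k
    _ = (L + c + k + 1) ^ ((c + 1) * k) := by rw [← pow_mul]
    _ ≤ (L + ((c + 1) * k + c + k + 1)) ^ ((c + 1) * k) := Nat.pow_le_pow_left (by omega) _
    _ ≤ (L + ((c + 1) * k + c + k + 1)) ^ ((c + 1) * k + c + k + 1) :=
        Nat.pow_le_pow_right (by omega) (by omega)

/-- **The bridge is kernel-checked**: a negative answer to Hertrich–Loho Q5.1 in the quasi-polynomial form `DeVirt k` (for ANY `k`)
implies VXC-MINKOWSKI, using the tree's PROVED K1 `QueueGridFace.nfPolytopeQuasiPolyXC_holds` (xc(NFP_n) super-quasi-polynomial). -/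
theorem vxcMinkowskiHard_of_deVirt (k : ℕ) (hD : DeVirt k) : VxcMinkowskiHard := by
  classical
  -- K1 in the `MonomialCofactor.newt` vocabulary (the route decl unfolds to it by `rfl`, as in `nnMonomialCofactorHard_lib`)
  have hK : ∀ c : ℕ, ∃ n₀ : ℕ, ∀ n ≥ n₀, ∀ r : ℕ,
      HasEFOfSize (Summit.ValiantsHypothesis.ValiantsHypothesis.Theorems.FifoMatching.QueueGridFace.newt
        (nestFreeMatchingPoly n ℝ≥0)) r → 2 ^ ((Nat.log 2 n + c) ^ c) < r :=
    Summit.ValiantsHypothesis.ValiantsHypothesis.Theorems.FifoMatching.QueueGridFace.nfPolytopeQuasiPolyXC_holds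
  intro c
  obtain ⟨n₀, hn₀⟩ := hK ((c + 1) * k + c + k + 1)
  refine ⟨max n₀ 2, fun n hn h hh a b hab hR hQ => ?_⟩
  have hn₀' : n₀ ≤ n := (le_max_left _ _).trans hn
  have hn2 : 2 ≤ n := (le_max_right _ _).trans hn
  have hL : 1 ≤ Nat.log 2 n := by
    have : Nat.log 2 2 = 1 := by decide
    rw [← this]; exact Nat.log_mono_right hn2
  -- the two finite point sets
  have hSfin : (Literature.Algebra.Polynomial.NewtonPolytope.exponentPt ℝ ''
      ((MvPolynomial.map NNReal.toRealHom (nestFreeMatchingPoly n ℝ≥0)).support : Set ((Fin (2 * n) × Fin (2 * n)) →₀ ℕ))).Finite :=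
    Set.toFinite _
  have hTfin : (Literature.Algebra.Polynomial.NewtonPolytope.exponentPt ℝ ''
      ((MvPolynomial.map NNReal.toRealHom h).support : Set ((Fin (2 * n) × Fin (2 * n)) →₀ ℕ))).Finite :=
    Set.toFinite _
  have hSne : (Literature.Algebra.Polynomial.NewtonPolytope.exponentPt ℝ ''
      ((MvPolynomial.map NNReal.toRealHom (nestFreeMatchingPoly n ℝ≥0)).support : Set ((Fin (2 * n) × Fin (2 * n)) →₀ ℕ))).Nonempty := by
    apply Set.Nonempty.image
    rw [MvPolynomial.support_map_of_injective _ NNReal.coe_injective]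
    exact Finset.coe_nonempty.mpr (Finset.nonempty_iff_ne_empty.mpr
      (fun he => Summit.ValiantsHypothesis.ValiantsHypothesis.Theorems.FifoMatching.MonomialCofactor.nn_ne_zero n
        (MvPolynomial.support_eq_empty.mp he)))
  have hTne : (Literature.Algebra.Polynomial.NewtonPolytope.exponentPt ℝ ''
      ((MvPolynomial.map NNReal.toRealHom h).support : Set ((Fin (2 * n) × Fin (2 * n)) →₀ ℕ))).Nonempty := by
    apply Set.Nonempty.image
    rw [MvPolynomial.support_map_of_injective _ NNReal.coe_injective]
    exact Finset.coe_nonempty.mpr (Finset.nonempty_iff_ne_empty.mpr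
      (fun he => hh (MvPolynomial.support_eq_empty.mp he)))
  -- K1 forbids an EF of NFP_n of threshold size
  have hnot : ¬ HasEFOfSize (nfp n) (2 ^ ((Nat.log 2 n + ((c + 1) * k + c + k + 1)) ^ ((c + 1) * k + c + k + 1))) := by
    intro hE
    have hE' : HasEFOfSize (Summit.ValiantsHypothesis.ValiantsHypothesis.Theorems.FifoMatching.QueueGridFace.newt
        (nestFreeMatchingPoly n ℝ≥0)) (2 ^ ((Nat.log 2 n + ((c + 1) * k + c + k + 1)) ^ ((c + 1) * k + c + k + 1))) := by
      rw [Summit.ValiantsHypothesis.ValiantsHypothesis.Theorems.FifoMatching.MonomialCofactor.newt_eq_newtonPolytope]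
      exact hE
    exact lt_irrefl _ (hn₀ n hn₀' _ hE')
  -- de-virtualize
  have hlt := hD (Fin (2 * n) × Fin (2 * n)) _ _ hSfin hSne hTfin hTne (3 * a) (3 * b) _ hR hQ hnot
  have hth := deVirt_threshold c k (Nat.log 2 n) (3 * a + 3 * b) hL (by omega)
  exact absurd hlt (not_lt.mpr (Nat.pow_le_pow_right (by norm_num) hth))

/-- `DeVirtGlue` holds (the K1 hypothesis is even superfluous: it is a theorem of the tree). -/
theorem deVirtGlue_holds : DeVirtGlue := fun k hD _ => vxcMinkowskiHard_of_deVirt k hD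

/-- **21181 ⟸ DeVirt k, by name** (CONDITIONAL bridge of card `devirtualize`, fully kernel-checked; `DeVirt k` is the only open input). -/
theorem nnDivisionHard_of_deVirt (k : ℕ) (hD : DeVirt k) :
    Summit.ValiantsHypothesis.ValiantsHypothesis.Theses.FifoMatching.NNDivisionHard :=
  nnDivisionHard_of_vxcMinkowski (vxcMinkowskiHard_of_deVirt k hD)

/-! ## §D  support lemmas for `AffineDeVirt` (the mathematics; EF packaging left to a prover) -/

/-- **Rådström cancellation** in the form the de-virtualization needs: if `P` is closed convex, `Q` compact nonempty and
`x + Q ⊆ P + Q`, then `x ∈ P` (separate `x` from `P`, maximise the functional over `Q`). [folklore; Schneider, Convex Bodies §3.1] -/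
theorem mem_of_add_subset_add {ι : Type} [Fintype ι] {P Q : Set (ι → ℝ)} (hPc : Convex ℝ P) (hPcl : IsClosed P)
    (hQ : IsCompact Q) (hQne : Q.Nonempty) {x : ι → ℝ} (h : {x} + Q ⊆ P + Q) : x ∈ P := by
  by_contra hx
  obtain ⟨f, u, hfP, hux⟩ := geometric_hahn_banach_closed_point hPc hPcl hx
  -- maximise f over the compact Q
  obtain ⟨q₀, hq₀Q, hq₀max⟩ := hQ.exists_isMaxOn hQne f.continuous.continuousOn
  have hmem : x + q₀ ∈ P + Q := h (Set.add_mem_add (Set.mem_singleton x) hq₀Q)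
  obtain ⟨p, hp, q, hq, hpq⟩ := Set.mem_add.mp hmem
  have h1 : f p < u := hfP p hp
  have h2 : f q ≤ f q₀ := hq₀max hq
  have h3 : f (x + q₀) = f (p + q) := by rw [hpq]
  rw [map_add, map_add] at h3
  linarith

/-- **Soundness of the dual certificate** (the «easy» direction of `AffineDeVirt`, one row `j` at a time): Farkas multipliers `μ`
with `Y_j = μ ᵥ* E_Q`, `μ ᵥ* F_Q ≤ 0` and `0 ≤ μ ⬝ᵥ g_Q + y₀_j` certify `0 ≤ y₀_j + Y_j ⬝ᵥ u` for every passenger point `u ∈ Q = QQ.projSet`.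
[folklore LP duality] -/
theorem affineRow_nonneg_of_certificate {ι : Type} [Fintype ι] {s : ℕ} (QQ : ExtendedFormulation ι s)
    (yrow : ι → ℝ) (c : ℝ) (μ : Fin QQ.k → ℝ)
    (hY : yrow = μ ᵥ* QQ.E) (hF : ∀ i, (μ ᵥ* QQ.F) i ≤ 0) (hc : 0 ≤ μ ⬝ᵥ QQ.g + c) :
    ∀ u ∈ QQ.projSet, 0 ≤ c + yrow ⬝ᵥ u := by
  intro u hu
  obtain ⟨v, hv, huv⟩ := hu
  have h1 : yrow ⬝ᵥ u = μ ⬝ᵥ (QQ.E *ᵥ u) := by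
    rw [hY, Matrix.dotProduct_mulVec]
  have h2 : QQ.E *ᵥ u = QQ.g - QQ.F *ᵥ v := by
    rw [← huv]; simp
  have h3 : μ ⬝ᵥ (QQ.F *ᵥ v) ≤ 0 := by
    rw [Matrix.dotProduct_mulVec]
    -- (μ ᵥ* F) ≤ 0 and v ≥ 0
    unfold dotProduct
    apply Finset.sum_nonpos
    intro i _
    exact mul_nonpos_of_nonpos_of_nonneg (hF i) (hv i)
  rw [h1, h2, dotProduct_sub]
  linarith

/-- **Completeness of the dual certificate** (the LP-duality direction of `AffineDeVirt`, one row at a time, from the tree's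
`LPDuality.affine_farkas` = Schrijver Cor. 7.1h): if `0 ≤ c + Y_j ⬝ᵥ u` for all `u` in the NONEMPTY passenger `Q = QQ.projSet`, then Farkas
multipliers as in `affineRow_nonneg_of_certificate` exist.  Together the two lemmas say: «affine rule feasible on Q» is a system of
`s + 1` linear inequalities (in `μ, y₀_j, Y_j`) per row `j` — the count `r·(s+1)` of `AffineDeVirt`. [folklore LP duality] -/
def AffineRowCertificateComplete : Prop :=
  ∀ (ι : Type) [Fintype ι] (s : ℕ) (QQ : ExtendedFormulation ι s) (yrow : ι → ℝ) (c : ℝ),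
    QQ.projSet.Nonempty → (∀ u ∈ QQ.projSet, 0 ≤ c + yrow ⬝ᵥ u) →
    ∃ μ : Fin QQ.k → ℝ, yrow = μ ᵥ* QQ.E ∧ (∀ i, (μ ᵥ* QQ.F) i ≤ 0) ∧ 0 ≤ μ ⬝ᵥ QQ.g + c

/-- `AffineRowCertificateComplete` holds — LP duality via the tree's `LPDuality.affine_farkas` (Schrijver Cor. 7.1h) applied to the lifted
system `E_Q u + F_Q v = g_Q, v ≥ 0` in the variables `z = (u, v)`. [folklore LP duality] -/
theorem affineRowCertificateComplete_holds : AffineRowCertificateComplete := by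
  intro ι _ s QQ yrow c hne hval
  classical
  -- rows: (E-rows ≤) ⊕ (E-rows ≥, written as −… ≤ −g) ⊕ (−v ≤ 0); columns: u-coordinates ⊕ v-coordinates
  let A : Matrix ((Fin QQ.k ⊕ Fin QQ.k) ⊕ Fin s) (ι ⊕ Fin s) ℝ := Matrix.of fun i j =>
    match i with
    | Sum.inl (Sum.inl i') => Sum.elim (fun j' => QQ.E i' j') (fun j' => QQ.F i' j') j
    | Sum.inl (Sum.inr i') => - Sum.elim (fun j' => QQ.E i' j') (fun j' => QQ.F i' j') j
    | Sum.inr i' => Sum.elim (fun _ => (0 : ℝ)) (fun j' => if j' = i' then (-1 : ℝ) else 0) j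
  let b : ((Fin QQ.k ⊕ Fin QQ.k) ⊕ Fin s) → ℝ := Sum.elim (Sum.elim QQ.g (-QQ.g)) (fun _ => 0)
  let cc : ι ⊕ Fin s → ℝ := Sum.elim (-yrow) (fun _ => 0)
  -- evaluation of the three row blocks
  have hrow1 : ∀ z : ι ⊕ Fin s → ℝ, ∀ i' : Fin QQ.k,
      (A *ᵥ z) (Sum.inl (Sum.inl i')) = (QQ.E *ᵥ (fun j => z (Sum.inl j)) + QQ.F *ᵥ (fun j => z (Sum.inr j))) i' := by
    intro z i'
    simp [A, Matrix.mulVec, dotProduct, Fintype.sum_sum_type, Matrix.of_apply]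
  have hrow2 : ∀ z : ι ⊕ Fin s → ℝ, ∀ i' : Fin QQ.k,
      (A *ᵥ z) (Sum.inl (Sum.inr i')) = - (QQ.E *ᵥ (fun j => z (Sum.inl j)) + QQ.F *ᵥ (fun j => z (Sum.inr j))) i' := by
    intro z i'
    simp [A, Matrix.mulVec, dotProduct, Fintype.sum_sum_type, Matrix.of_apply, Finset.sum_neg_distrib, neg_add]
  have hrow3 : ∀ z : ι ⊕ Fin s → ℝ, ∀ i' : Fin s, (A *ᵥ z) (Sum.inr i') = - z (Sum.inr i') := by
    intro z i'
    simp [A, Matrix.mulVec, dotProduct, Fintype.sum_sum_type, Matrix.of_apply]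
  -- A z ≤ b ↔ lifted feasibility
  have hAz : ∀ z : ι ⊕ Fin s → ℝ, A *ᵥ z ≤ b ↔
      (QQ.E *ᵥ (fun j => z (Sum.inl j)) + QQ.F *ᵥ (fun j => z (Sum.inr j)) = QQ.g ∧ ∀ j, 0 ≤ z (Sum.inr j)) := by
    intro z
    constructor
    · intro h
      refine ⟨?_, ?_⟩
      · funext i'
        have h1 := h (Sum.inl (Sum.inl i'))
        have h2 := h (Sum.inl (Sum.inr i'))
        rw [hrow1] at h1
        rw [hrow2] at h2
        simp [b] at h1 h2
        rw [Pi.add_apply]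
        linarith
      · intro j
        have h3 := h (Sum.inr j)
        rw [hrow3] at h3
        simp [b] at h3
        linarith
    · rintro ⟨heq, hv⟩ i
      rcases i with (i' | i') | i'
      · rw [hrow1, heq]; simp [b]
      · rw [hrow2, heq]; simp [b]
      · rw [hrow3]; simp [b]; linarith [hv i']
  -- feasibility and validity of `cc ⬝ᵥ z ≤ c`
  have hP : ∃ z : ι ⊕ Fin s → ℝ, A *ᵥ z ≤ b := by
    obtain ⟨u, v, hv, huv⟩ := hne
    refine ⟨Sum.elim u v, (hAz _).mpr ⟨?_, fun j => by simpa using hv j⟩⟩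
    simpa using huv
  have hcc : ∀ z : ι ⊕ Fin s → ℝ, cc ⬝ᵥ z = - (yrow ⬝ᵥ fun j => z (Sum.inl j)) := by
    intro z
    simp [cc, dotProduct, Fintype.sum_sum_type, Finset.sum_neg_distrib]
  have hδ : ∀ z : ι ⊕ Fin s → ℝ, A *ᵥ z ≤ b → cc ⬝ᵥ z ≤ c := by
    intro z hz
    obtain ⟨heq, hv⟩ := (hAz z).mp hz
    have hu : (fun j => z (Sum.inl j)) ∈ QQ.projSet := ⟨fun j => z (Sum.inr j), hv, heq⟩
    have := hval _ hu
    rw [hcc]; linarith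
  obtain ⟨y, hy, hyA, hyb⟩ := Literature.Analysis.Convex.LPDuality.affine_farkas A b cc hP hδ
  -- read off the multipliers
  refine ⟨fun i' => y (Sum.inl (Sum.inr i')) - y (Sum.inl (Sum.inl i')), ?_, ?_, ?_⟩
  · funext j'
    have h := congr_fun hyA (Sum.inl j')
    simp [A, cc, Matrix.vecMul, dotProduct, Fintype.sum_sum_type, Matrix.of_apply] at h
    simp [Matrix.vecMul, dotProduct, sub_mul, Finset.sum_sub_distrib]
    linarith
  · intro j'
    have h := congr_fun hyA (Sum.inr j')
    simp [A, cc, Matrix.vecMul, dotProduct, Fintype.sum_sum_type, Matrix.of_apply] at h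
    have hy3 : 0 ≤ y (Sum.inr j') := hy (Sum.inr j')
    simp [Matrix.vecMul, dotProduct, sub_mul, Finset.sum_sub_distrib]
    linarith
  · have h := hyb
    simp [b, dotProduct, Fintype.sum_sum_type, Finset.sum_neg_distrib] at h
    simp [dotProduct, sub_mul, Finset.sum_sub_distrib]
    linarith

/-! ## §E  EF packaging tools (towards the full `AffineDeVirt`) -/

/-- A set cut out by finitely many linear EQUALITIES and finitely many linear INEQUALITIES (given as linear functionals on
`J → ℝ`) has an EF of size = the number of inequalities (free natural variables; slack form via `hasEFOfSize_of_system`). [folklore] -/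
theorem hasEFOfSize_of_linConstraints {J A B : Type} [Fintype J] [DecidableEq J] [Fintype A] [Fintype B] [DecidableEq B]
    (φ : A → ((J → ℝ) →ₗ[ℝ] ℝ)) (α : A → ℝ) (ψ : B → ((J → ℝ) →ₗ[ℝ] ℝ)) (β : B → ℝ) :
    HasEFOfSize {W : J → ℝ | (∀ a, φ a W = α a) ∧ (∀ b, β b ≤ ψ b W)} (Fintype.card B) := by
  classical
  let va : A → J → ℝ := fun a j => φ a (fun j' => if j = j' then 1 else 0)
  let vb : B → J → ℝ := fun b j => ψ b (fun j' => if j = j' then 1 else 0)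
  have hva : ∀ a W, va a ⬝ᵥ W = φ a W := by
    intro a W
    rw [LinearMap.pi_apply_eq_sum_univ (φ a) W]
    simp [va, dotProduct, mul_comm]
  have hvb : ∀ b W, vb b ⬝ᵥ W = ψ b W := by
    intro b W
    rw [LinearMap.pi_apply_eq_sum_univ (ψ b) W]
    simp [vb, dotProduct, mul_comm]
  let E : Matrix (A ⊕ B) J ℝ := Matrix.of fun ρ j => match ρ with
    | Sum.inl a => va a j
    | Sum.inr b => vb b j
  let F : Matrix (A ⊕ B) B ℝ := Matrix.of fun ρ b' => match ρ with
    | Sum.inl _ => (0 : ℝ)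
    | Sum.inr b => if b = b' then (-1 : ℝ) else 0
  let g : A ⊕ B → ℝ := Sum.elim α β
  have hE1 : ∀ W a, (E *ᵥ W) (Sum.inl a) = φ a W := by
    intro W a; rw [← hva]; simp [E, Matrix.mulVec, dotProduct, Matrix.of_apply]
  have hE2 : ∀ W b, (E *ᵥ W) (Sum.inr b) = ψ b W := by
    intro W b; rw [← hvb]; simp [E, Matrix.mulVec, dotProduct, Matrix.of_apply]
  have hF1 : ∀ ν a, (F *ᵥ ν) (Sum.inl a) = 0 := by
    intro ν a; simp [F, Matrix.mulVec, dotProduct, Matrix.of_apply]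
  have hF2 : ∀ ν b, (F *ᵥ ν) (Sum.inr b) = - ν b := by
    intro ν b; simp [F, Matrix.mulVec, dotProduct, Matrix.of_apply, ite_mul]
  have h0 := Literature.Barriers.PneNP.hasEFOfSize_of_system (ι := J) E F g
  convert h0 using 1
  ext W
  simp only [Set.mem_setOf_eq]
  constructor
  · rintro ⟨hA, hB⟩
    refine ⟨fun b => ψ b W - β b, fun b => by linarith [hB b], ?_⟩
    funext ρ
    rcases ρ with a | b
    · simp only [Pi.add_apply, hE1, hF1, g, Sum.elim_inl, add_zero]; exact hA a
    · simp only [Pi.add_apply, hE2, hF2, g, Sum.elim_inr]; ring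
  · rintro ⟨ν, hν, hsys⟩
    refine ⟨fun a => ?_, fun b => ?_⟩
    · have := congr_fun hsys (Sum.inl a)
      simp only [Pi.add_apply, hE1, hF1, g, Sum.elim_inl, add_zero] at this; exact this
    · have := congr_fun hsys (Sum.inr b)
      simp only [Pi.add_apply, hE2, hF2, g, Sum.elim_inr] at this
      linarith [hν b]

/-- Finitely many DIRECTIONS `d t` spanning the direction space of `Q` at `u₀ ∈ Q`: a linear functional is constant on `Q` iff it kills
every `d t` (a basis of `span (Q − u₀)`).  This turns «equality for all passenger points u ∈ Q» into finitely many linear equalities. [folklore] -/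
theorem exists_dirs {ι : Type} [Fintype ι] (Q : Set (ι → ℝ)) {u₀ : ι → ℝ} (hu₀ : u₀ ∈ Q) :
    ∃ (m : ℕ) (d : Fin m → (ι → ℝ)), ∀ a : ι → ℝ, (∀ u ∈ Q, a ⬝ᵥ u = a ⬝ᵥ u₀) ↔ (∀ t, a ⬝ᵥ d t = 0) := by
  classical
  let V : Submodule ℝ (ι → ℝ) := Submodule.span ℝ ((fun u => u - u₀) '' Q)
  let bV := Module.finBasis ℝ V
  refine ⟨Module.finrank ℝ V, fun t => (bV t : ι → ℝ), fun a => ?_⟩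
  -- the functional v ↦ a ⬝ᵥ v as a linear map
  let f : (ι → ℝ) →ₗ[ℝ] ℝ :=
    { toFun := fun v => a ⬝ᵥ v
      map_add' := fun v w => by simp [dotProduct_add]
      map_smul' := fun c v => by simp [dotProduct_smul] }
  constructor
  · intro h t
    have hle : V ≤ LinearMap.ker f := by
      rw [Submodule.span_le]
      rintro _ ⟨u, hu, rfl⟩
      simp only [SetLike.mem_coe, LinearMap.mem_ker]
      show a ⬝ᵥ (u - u₀) = 0
      rw [dotProduct_sub, h u hu, sub_self]
    have := hle (bV t).2
    simpa [f] using this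
  · intro h u hu
    have hmem : u - u₀ ∈ V := Submodule.subset_span ⟨u, hu, rfl⟩
    have hf' : f ∘ₗ V.subtype = 0 := bV.ext fun t => by simpa [f] using h t
    have hzero : a ⬝ᵥ (u - u₀) = 0 := by
      have := LinearMap.congr_fun hf' ⟨u - u₀, hmem⟩
      simpa [f] using this
    rw [dotProduct_sub] at hzero
    linarith

/-- matrix version of `hasEFOfSize_of_linConstraints`. [folklore] -/
theorem hasEFOfSize_of_matConstraints {J A B : Type} [Fintype J] [DecidableEq J] [Fintype A] [Fintype B] [DecidableEq B]
    (M : Matrix A J ℝ) (α : A → ℝ) (N : Matrix B J ℝ) (β : B → ℝ) :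
    HasEFOfSize {W : J → ℝ | M *ᵥ W = α ∧ ∀ b, β b ≤ (N *ᵥ W) b} (Fintype.card B) := by
  have h := hasEFOfSize_of_linConstraints (fun a => (LinearMap.proj a) ∘ₗ M.mulVecLin) α
    (fun b => (LinearMap.proj b) ∘ₗ N.mulVecLin) β
  convert h using 1
  ext W
  simp only [Set.mem_setOf_eq, LinearMap.coe_comp, Function.comp_apply, Matrix.mulVecLin_apply,
    LinearMap.coe_proj, Function.eval, funext_iff]

/-- **Bounded cancellation**: `mem_of_add_subset_add` with `Q` only bounded (pass to the compact closure). [folklore] -/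
theorem mem_of_add_subset_add' {ι : Type} [Fintype ι] {P Q : Set (ι → ℝ)} (hPc : Convex ℝ P) (hPcl : IsClosed P)
    (hQ : Bornology.IsBounded Q) (hQne : Q.Nonempty) {x : ι → ℝ} (h : ∀ u ∈ Q, x + u ∈ P + Q) : x ∈ P := by
  have hK : IsCompact (closure Q) := hQ.isCompact_closure
  have hKne : (closure Q).Nonempty := hQne.mono subset_closure
  have hPK : IsClosed (P + closure Q) := hPcl.add_right_of_isCompact hK
  refine mem_of_add_subset_add hPc hPcl hK hKne ?_
  rintro _ ⟨x', hx', k, hk, rfl⟩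
  rw [Set.mem_singleton_iff] at hx'
  subst hx'
  -- x' + k ∈ closure ((x' + ·) '' Q) ⊆ closure (P + Q) ⊆ P + closure Q
  have hcont : Continuous (fun u : ι → ℝ => x' + u) := continuous_const.add continuous_id
  have h1 : x' + k ∈ closure ((fun u => x' + u) '' Q) :=
    image_closure_subset_closure_image hcont ⟨k, hk, rfl⟩
  have h2 : (fun u => x' + u) '' Q ⊆ P + closure Q := by
    rintro _ ⟨u, hu, rfl⟩
    exact Set.add_subset_add_left subset_closure (h u hu)
  exact hPK.closure_subset_iff.mpr h2 h1

/-- **The affinely-adjustable set is a polytope shadow of size `r·(s+1)`** (core packaging fact, no hypothesis on `R`):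
for any EFs `RR` (size `r`), `QQ` (size `s`, nonempty shadow `Q`), the set of points `x` admitting an AFFINE decision rule
`u ↦ y₀ + Y u ≥ 0` with `E_R (x+u) + F_R (y₀ + Y u) = g_R` on all of `Q` has an honest EF with `r(s+1)` inequalities
(LP duality row by row, §D; the equalities on `Q` become finitely many equalities via `exists_dirs`; packaging by
`hasEFOfSize_of_matConstraints` + `HasEFOfSize.image_linearMap`). [folklore: affinely adjustable robust LP, Ben-Tal–Goryashko–Guslitzer–Nemirovski 2004] -/
theorem hasEFOfSize_affineRuleSet {ι : Type} [Fintype ι] {r s : ℕ} (RR : ExtendedFormulation ι r) (QQ : ExtendedFormulation ι s)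
    (hne : QQ.projSet.Nonempty) : HasEFOfSize {x | HasAffineRule RR QQ x} (r * (s + 1)) := by
  classical
  obtain ⟨u₀, hu₀⟩ := hne
  obtain ⟨m, d, hd⟩ := exists_dirs QQ.projSet hu₀
  -- natural variables W : J → ℝ  =  (x, y₀, Y, μ),  J = ((ι ⊕ Fin r) ⊕ (Fin r × ι)) ⊕ (Fin r × Fin QQ.k)
  let xW : ((((ι ⊕ Fin r) ⊕ (Fin r × ι)) ⊕ (Fin r × Fin QQ.k)) → ℝ) → (ι → ℝ) := fun W i => W (Sum.inl (Sum.inl (Sum.inl i)))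
  let yW : ((((ι ⊕ Fin r) ⊕ (Fin r × ι)) ⊕ (Fin r × Fin QQ.k)) → ℝ) → (Fin r → ℝ) := fun W j => W (Sum.inl (Sum.inl (Sum.inr j)))
  let YW : ((((ι ⊕ Fin r) ⊕ (Fin r × ι)) ⊕ (Fin r × Fin QQ.k)) → ℝ) → Matrix (Fin r) ι ℝ := fun W j i => W (Sum.inl (Sum.inr (j, i)))
  let μW : ((((ι ⊕ Fin r) ⊕ (Fin r × ι)) ⊕ (Fin r × Fin QQ.k)) → ℝ) → Fin r → (Fin QQ.k → ℝ) := fun W j q => W (Sum.inr (j, q))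
  -- equality rows: C1 (Y = μ E_Q) ⊕ C4 (equation at u₀) ⊕ C5 (rows of E_R + F_R Y kill the directions)
  let M : Matrix (((Fin r × ι) ⊕ Fin RR.k) ⊕ (Fin m × Fin RR.k)) (((ι ⊕ Fin r) ⊕ (Fin r × ι)) ⊕ (Fin r × Fin QQ.k)) ℝ := Matrix.of fun ρ c =>
    match ρ with
    | Sum.inl (Sum.inl (j, i)) =>
      (match c with
        | Sum.inl (Sum.inl _) => (0 : ℝ)
        | Sum.inl (Sum.inr (j', i')) => if j' = j then (if i' = i then 1 else 0) else 0
        | Sum.inr (j', q) => if j' = j then - QQ.E q i else 0)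
    | Sum.inl (Sum.inr ρ') =>
      (match c with
        | Sum.inl (Sum.inl (Sum.inl i')) => RR.E ρ' i'
        | Sum.inl (Sum.inl (Sum.inr j')) => RR.F ρ' j'
        | Sum.inl (Sum.inr (j', i')) => RR.F ρ' j' * u₀ i'
        | Sum.inr _ => 0)
    | Sum.inr (t, ρ') =>
      (match c with
        | Sum.inl (Sum.inl _) => (0 : ℝ)
        | Sum.inl (Sum.inr (j', i')) => RR.F ρ' j' * d t i'
        | Sum.inr _ => 0)
  let α : (((Fin r × ι) ⊕ Fin RR.k) ⊕ (Fin m × Fin RR.k)) → ℝ := fun ρ =>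
    match ρ with
    | Sum.inl (Sum.inl _) => 0
    | Sum.inl (Sum.inr ρ') => RR.g ρ' - (RR.E *ᵥ u₀) ρ'
    | Sum.inr (t, ρ') => - ((fun i => RR.E ρ' i) ⬝ᵥ d t)
  -- inequality rows: C2 (μ_j F_Q ≤ 0) ⊕ C3 (0 ≤ μ_j g_Q + y₀_j)
  let N : Matrix ((Fin r × Fin s) ⊕ Fin r) (((ι ⊕ Fin r) ⊕ (Fin r × ι)) ⊕ (Fin r × Fin QQ.k)) ℝ := Matrix.of fun ρ c =>
    match ρ with
    | Sum.inl (j, i') =>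
      (match c with
        | Sum.inl _ => (0 : ℝ)
        | Sum.inr (j', q) => if j' = j then - QQ.F q i' else 0)
    | Sum.inr j =>
      (match c with
        | Sum.inl (Sum.inl (Sum.inl _)) => (0 : ℝ)
        | Sum.inl (Sum.inl (Sum.inr j')) => if j' = j then 1 else 0
        | Sum.inl (Sum.inr _) => 0
        | Sum.inr (j', q) => if j' = j then QQ.g q else 0)
  let β : ((Fin r × Fin s) ⊕ Fin r) → ℝ := fun _ => 0
  -- row evaluations
  have hM1 : ∀ W j i, (M *ᵥ W) (Sum.inl (Sum.inl (j, i))) = YW W j i - (μW W j ᵥ* QQ.E) i := by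
    intro W j i
    simp [M, YW, μW, Matrix.mulVec, Matrix.vecMul, dotProduct, Fintype.sum_sum_type, Fintype.sum_prod_type,
      Matrix.of_apply, ite_mul, mul_ite, Finset.sum_ite_eq', Finset.sum_ite_eq, Finset.sum_neg_distrib, mul_comm, sub_eq_add_neg]
  have hM2 : ∀ W ρ', (M *ᵥ W) (Sum.inl (Sum.inr ρ')) =
      (RR.E *ᵥ xW W) ρ' + (RR.F *ᵥ yW W) ρ' + (RR.F *ᵥ (YW W *ᵥ u₀)) ρ' := by
    intro W ρ'
    simp [M, xW, yW, YW, Matrix.mulVec, dotProduct, Fintype.sum_sum_type, Fintype.sum_prod_type, Matrix.of_apply,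
      Finset.mul_sum, mul_assoc, mul_comm, mul_left_comm]
  have hM3 : ∀ W t ρ', (M *ᵥ W) (Sum.inr (t, ρ')) = (RR.F *ᵥ (YW W *ᵥ d t)) ρ' := by
    intro W t ρ'
    simp [M, YW, Matrix.mulVec, dotProduct, Fintype.sum_sum_type, Fintype.sum_prod_type, Matrix.of_apply,
      Finset.mul_sum, mul_assoc, mul_comm, mul_left_comm]
  have hN1 : ∀ W j i', (N *ᵥ W) (Sum.inl (j, i')) = - (μW W j ᵥ* QQ.F) i' := by
    intro W j i'
    simp [N, μW, Matrix.mulVec, Matrix.vecMul, dotProduct, Fintype.sum_sum_type, Fintype.sum_prod_type, Matrix.of_apply,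
      ite_mul, mul_ite, Finset.sum_ite_eq', Finset.sum_ite_eq, Finset.sum_neg_distrib, mul_comm]
  have hN2 : ∀ W j, (N *ᵥ W) (Sum.inr j) = μW W j ⬝ᵥ QQ.g + yW W j := by
    intro W j
    simp [N, μW, yW, Matrix.mulVec, dotProduct, Fintype.sum_sum_type, Fintype.sum_prod_type, Matrix.of_apply,
      ite_mul, mul_ite, Finset.sum_ite_eq', Finset.sum_ite_eq, mul_comm, add_comm]
  -- the lifted set and its EF
  let S : Set ((((ι ⊕ Fin r) ⊕ (Fin r × ι)) ⊕ (Fin r × Fin QQ.k)) → ℝ) := {W | M *ᵥ W = α ∧ ∀ b, β b ≤ (N *ᵥ W) b}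
  have hS : HasEFOfSize S (Fintype.card ((Fin r × Fin s) ⊕ Fin r)) := hasEFOfSize_of_matConstraints M α N β
  have hcard : Fintype.card ((Fin r × Fin s) ⊕ Fin r) = r * (s + 1) := by
    simp [Fintype.card_sum, Fintype.card_prod, Fintype.card_fin]; ring
  rw [hcard] at hS
  -- projection to the x-coordinates
  let px : ((((ι ⊕ Fin r) ⊕ (Fin r × ι)) ⊕ (Fin r × Fin QQ.k)) → ℝ) →ₗ[ℝ] (ι → ℝ) := LinearMap.funLeft ℝ ℝ (fun i : ι => (Sum.inl (Sum.inl (Sum.inl i)) : (((ι ⊕ Fin r) ⊕ (Fin r × ι)) ⊕ (Fin r × Fin QQ.k))))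
  have hpx : ∀ W, px W = xW W := fun W => rfl
  have himg := hS.image_linearMap px
  -- a row functional constant on Q: rows of E_R + F_R Y
  have hrowfun : ∀ (Y : Matrix (Fin r) ι ℝ) (u : ι → ℝ) (ρ' : Fin RR.k),
      (RR.E *ᵥ u) ρ' + (RR.F *ᵥ (Y *ᵥ u)) ρ' = (fun i => RR.E ρ' i + (RR.F * Y) ρ' i) ⬝ᵥ u := by
    intro Y u ρ'
    rw [Matrix.mulVec_mulVec]
    simp [Matrix.mulVec, dotProduct, add_mul, Finset.sum_add_distrib]
  have hErow : ∀ (v : ι → ℝ) (ρ' : Fin RR.k), (RR.E *ᵥ v) ρ' = (fun i => RR.E ρ' i) ⬝ᵥ v := fun v ρ' => rfl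
  suffices hPS : px '' S = {x | HasAffineRule RR QQ x} by rw [hPS] at himg; exact himg
  ext x
  constructor
  · -- (⊇): a feasible certificate is an affine rule
    rintro ⟨W, ⟨hMW, hNW⟩, rfl⟩
    rw [hpx]
    have hC1 : ∀ j, YW W j = μW W j ᵥ* QQ.E := by
      intro j; funext i
      have := congr_fun hMW (Sum.inl (Sum.inl (j, i)))
      rw [hM1] at this
      simp only [α] at this
      linarith
    have hC2 : ∀ j i', (μW W j ᵥ* QQ.F) i' ≤ 0 := by
      intro j i'
      have := hNW (Sum.inl (j, i'))
      rw [hN1] at this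
      simp only [β] at this
      linarith
    have hC3 : ∀ j, 0 ≤ μW W j ⬝ᵥ QQ.g + yW W j := by
      intro j
      have := hNW (Sum.inr j)
      rw [hN2] at this
      simpa [β] using this
    have hC4 : ∀ ρ', (RR.E *ᵥ xW W) ρ' + (RR.F *ᵥ yW W) ρ' + (RR.F *ᵥ (YW W *ᵥ u₀)) ρ' = RR.g ρ' - (RR.E *ᵥ u₀) ρ' := by
      intro ρ'
      have := congr_fun hMW (Sum.inl (Sum.inr ρ'))
      rw [hM2] at this
      simpa [α] using this
    have hC5 : ∀ t ρ', (fun i => RR.E ρ' i + (RR.F * YW W) ρ' i) ⬝ᵥ d t = 0 := by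
      intro t ρ'
      have := congr_fun hMW (Sum.inr (t, ρ'))
      rw [hM3] at this
      simp only [α] at this
      have e := hrowfun (YW W) (d t) ρ'
      rw [hErow] at e
      linarith
    -- hence (yW W, YW W) is an affine rule for xW W
    refine ⟨yW W, YW W, fun u hu => ⟨fun j => ?_, ?_⟩⟩
    · have := affineRow_nonneg_of_certificate QQ (YW W j) (yW W j) (μW W j) (hC1 j) (hC2 j) (hC3 j) u hu
      simpa [Matrix.mulVec, Pi.add_apply] using this
    · funext ρ'
      have hconst := (hd (fun i => RR.E ρ' i + (RR.F * YW W) ρ' i)).mpr (fun t => hC5 t ρ') u hu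
      have e1 := hrowfun (YW W) u ρ'
      have e0 := hrowfun (YW W) u₀ ρ'
      have := hC4 ρ'
      simp only [Matrix.mulVec_add, Pi.add_apply]
      linarith
  · -- (⊆): an affine rule has row-wise Farkas certificates
    rintro ⟨y₀, Y, hY⟩
    have hcert : ∀ j, ∃ μ : Fin QQ.k → ℝ, Y j = μ ᵥ* QQ.E ∧ (∀ i, (μ ᵥ* QQ.F) i ≤ 0) ∧ 0 ≤ μ ⬝ᵥ QQ.g + y₀ j := by
      intro j
      refine affineRowCertificateComplete_holds ι s QQ (Y j) (y₀ j) ⟨u₀, hu₀⟩ ?_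
      intro u hu
      have := (hY u hu).1 j
      simpa [Matrix.mulVec, Pi.add_apply] using this
    choose μ hμ using hcert
    let W : (((ι ⊕ Fin r) ⊕ (Fin r × ι)) ⊕ (Fin r × Fin QQ.k)) → ℝ := fun c => match c with
      | Sum.inl (Sum.inl (Sum.inl i)) => x i
      | Sum.inl (Sum.inl (Sum.inr j)) => y₀ j
      | Sum.inl (Sum.inr (j, i)) => Y j i
      | Sum.inr (j, q) => μ j q
    have hxW : xW W = x := rfl
    have hyW : yW W = y₀ := rfl
    have hYW : YW W = Y := rfl
    have hμW : μW W = μ := rfl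
    refine ⟨W, ⟨?_, ?_⟩, by rw [hpx]⟩
    · funext ρ
      rcases ρ with ((⟨j, i⟩ | ρ') | ⟨t, ρ'⟩)
      · rw [hM1, hYW, hμW, (hμ j).1]; simp [α]
      · rw [hM2, hxW, hyW, hYW]
        have e0 := hrowfun Y u₀ ρ'
        have := congr_fun (hY u₀ hu₀).2 ρ'
        simp only [Matrix.mulVec_add, Pi.add_apply] at this
        simp only [α]
        linarith
      · rw [hM3, hYW]
        simp only [α]
        -- the row functional is constant on Q (equations at u and u₀), hence kills d t
        have hconst : ∀ u ∈ QQ.projSet, (fun i => RR.E ρ' i + (RR.F * Y) ρ' i) ⬝ᵥ u =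
            (fun i => RR.E ρ' i + (RR.F * Y) ρ' i) ⬝ᵥ u₀ := by
          intro u hu
          have e1 := hrowfun Y u ρ'
          have e0 := hrowfun Y u₀ ρ'
          have h1 := congr_fun (hY u hu).2 ρ'
          have h0 := congr_fun (hY u₀ hu₀).2 ρ'
          simp only [Matrix.mulVec_add, Pi.add_apply] at h1 h0
          linarith
        have hkill := (hd _).mp hconst t
        have e := hrowfun Y (d t) ρ'
        rw [hErow] at e
        linarith
    · intro b
      rcases b with (⟨j, i'⟩ | j)
      · rw [hN1, hμW]; simp only [β]; linarith [(hμ j).2.1 i']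
      · rw [hN2, hμW, hyW]; simp only [β]; exact (hμ j).2.2


/-- **`AffineDeVirt` holds**: under `R = P + Q` (`P` closed convex, `Q` bounded nonempty) the affinely-adjustable set IS `P`
(⊇ by hypothesis, ⊆ by bounded Rådström cancellation `mem_of_add_subset_add'`), so `hasEFOfSize_affineRuleSet` is an EF of `P`. -/
theorem affineDeVirt_holds : AffineDeVirt := by
  intro ι _ r s RR QQ P hPc hPcl hne hbdd hRPQ hrule
  have h := hasEFOfSize_affineRuleSet RR QQ hne
  suffices hS : {x | HasAffineRule RR QQ x} = P by rw [hS] at h; exact h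
  ext x
  constructor
  · rintro ⟨y₀, Y, hY⟩
    refine mem_of_add_subset_add' hPc hPcl hbdd hne fun u hu => ?_
    rw [← hRPQ]
    exact ⟨y₀ + Y *ᵥ u, (hY u hu).1, (hY u hu).2⟩
  · exact hrule x

/-! ## §F  the decided slice of COR-VIRTUAL: affine-recourse virtual EFs of `COR(K_h)` are exponential -/

/-- **Affine-recourse virtual extended formulations of `COR(K_h)` are exponential** (corollary of `affineDeVirt_holds` and the tree's
Kaibel–Weltge count `corPolytopeGraph_top_three_pow_le`): if `(RR, QQ)` is a virtual EF of `COR(K_h)` with passenger `Q = conv(range q)`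
(the objects of `CorVirtualHard`) and every point of `COR(K_h)` admits an AFFINE decision rule, then `3^h ≤ (r(s+1)+1)·2^h`, i.e.
`r(s+1) ≥ 1.5^h − 1`.  So a refuting cheap pair for the residual of record must use genuinely piecewise (high-adaptivity) recourse. -/
theorem affineVirtualCor_three_pow_le {h r s K : ℕ} (q : Fin (K + 1) → (Fin h × Fin h → ℝ))
    (RR : ExtendedFormulation (Fin h × Fin h) r) (QQ : ExtendedFormulation (Fin h × Fin h) s)
    (hQ : QQ.projSet = convexHull ℝ (Set.range q))
    (hR : RR.projSet = corPolytopeGraph (⊤ : SimpleGraph (Fin h)) + convexHull ℝ (Set.range q))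
    (hrule : ∀ x ∈ corPolytopeGraph (⊤ : SimpleGraph (Fin h)), HasAffineRule RR QQ x) :
    3 ^ h ≤ (r * (s + 1) + 1) * 2 ^ h := by
  have hconv : Convex ℝ (corPolytopeGraph (⊤ : SimpleGraph (Fin h))) := by
    unfold corPolytopeGraph; exact convex_convexHull ℝ _
  have hcl : IsClosed (corPolytopeGraph (⊤ : SimpleGraph (Fin h))) := by
    have hK : IsCompact (convexHull ℝ (Set.range (Literature.Combinatorics.Optimization.corVec (⊤ : SimpleGraph (Fin h))))) :=
      (Set.finite_range _).isCompact_convexHull (𝕜 := ℝ)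
    unfold corPolytopeGraph; exact hK.isClosed
  have hne : QQ.projSet.Nonempty := by
    rw [hQ]; exact ⟨q 0, subset_convexHull ℝ _ ⟨0, rfl⟩⟩
  have hbd : Bornology.IsBounded QQ.projSet := by
    have hK : IsCompact (convexHull ℝ (Set.range q)) := (Set.finite_range q).isCompact_convexHull (𝕜 := ℝ)
    rw [hQ]; exact hK.isBounded
  have hRPQ : RR.projSet = corPolytopeGraph (⊤ : SimpleGraph (Fin h)) + QQ.projSet := by rw [hR, hQ]
  have hP := affineDeVirt_holds (Fin h × Fin h) r s RR QQ _ hconv hcl hne hbd hRPQ hrule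
  exact Literature.Barriers.PneNP.corPolytopeGraph_top_three_pow_le hP

/-! ## §G  finite adaptability (k-piece recourse w.r.t. a fixed polyhedral cover of the passenger) -/

/-- Intersection of two EF'd sets: stack the systems (sizes add). [folklore] -/
theorem hasEFOfSize_inter {ι : Type} [Fintype ι] {P P' : Set (ι → ℝ)} {r r' : ℕ}
    (h : HasEFOfSize P r) (h' : HasEFOfSize P' r') : HasEFOfSize (P ∩ P') (r + r') := by
  classical
  obtain ⟨A, hA⟩ := h
  obtain ⟨B, hB⟩ := h'
  let E : Matrix (Fin A.k ⊕ Fin B.k) ι ℝ := Matrix.of fun ρ i => match ρ with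
    | Sum.inl a => A.E a i
    | Sum.inr b => B.E b i
  let F : Matrix (Fin A.k ⊕ Fin B.k) (Fin r ⊕ Fin r') ℝ := Matrix.of fun ρ c => match ρ, c with
    | Sum.inl a, Sum.inl j => A.F a j
    | Sum.inl _, Sum.inr _ => 0
    | Sum.inr _, Sum.inl _ => 0
    | Sum.inr b, Sum.inr j => B.F b j
  let g : Fin A.k ⊕ Fin B.k → ℝ := Sum.elim A.g B.g
  have hE1 : ∀ x a, (E *ᵥ x) (Sum.inl a) = (A.E *ᵥ x) a := by
    intro x a; simp [E, Matrix.mulVec, dotProduct, Matrix.of_apply]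
  have hE2 : ∀ x b, (E *ᵥ x) (Sum.inr b) = (B.E *ᵥ x) b := by
    intro x b; simp [E, Matrix.mulVec, dotProduct, Matrix.of_apply]
  have hF1 : ∀ (y : Fin r ⊕ Fin r' → ℝ) a, (F *ᵥ y) (Sum.inl a) = (A.F *ᵥ fun j => y (Sum.inl j)) a := by
    intro y a; simp [F, Matrix.mulVec, dotProduct, Matrix.of_apply, Fintype.sum_sum_type]
  have hF2 : ∀ (y : Fin r ⊕ Fin r' → ℝ) b, (F *ᵥ y) (Sum.inr b) = (B.F *ᵥ fun j => y (Sum.inr j)) b := by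
    intro y b; simp [F, Matrix.mulVec, dotProduct, Matrix.of_apply, Fintype.sum_sum_type]
  have h0 := Literature.Barriers.PneNP.hasEFOfSize_of_system (ι := ι) E F g
  simp only [Fintype.card_sum, Fintype.card_fin] at h0
  convert h0 using 1
  ext x
  rw [← hA, ← hB]
  simp only [Set.mem_inter_iff, Set.mem_setOf_eq, ExtendedFormulation.projSet]
  constructor
  · rintro ⟨⟨y, hy, hsy⟩, ⟨y', hy', hsy'⟩⟩
    refine ⟨Sum.elim y y', fun c => ?_, ?_⟩
    · rcases c with j | j
      · simpa using hy j
      · simpa using hy' j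
    funext ρ
    rcases ρ with a | b
    · rw [Pi.add_apply, hE1, hF1]; simpa [g] using congr_fun hsy a
    · rw [Pi.add_apply, hE2, hF2]; simpa [g] using congr_fun hsy' b
  · rintro ⟨y, hy, hsy⟩
    refine ⟨⟨fun j => y (Sum.inl j), fun j => hy _, ?_⟩, ⟨fun j => y (Sum.inr j), fun j => hy _, ?_⟩⟩
    · funext a
      have := congr_fun hsy (Sum.inl a)
      rw [Pi.add_apply, hE1, hF1] at this
      simpa [g] using this
    · funext b
      have := congr_fun hsy (Sum.inr b)
      rw [Pi.add_apply, hE2, hF2] at this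
      simpa [g] using this

/-- The whole space has an EF of size 0. [folklore] -/
theorem hasEFOfSize_univ {ι : Type} [Fintype ι] : HasEFOfSize (Set.univ : Set (ι → ℝ)) 0 := by
  classical
  have h := hasEFOfSize_of_matConstraints (J := ι) (A := Fin 0) (B := Fin 0)
    (0 : Matrix (Fin 0) ι ℝ) (fun _ => 0) (0 : Matrix (Fin 0) ι ℝ) (fun _ => 0)
  simp only [Fintype.card_fin] at h
  convert h using 1
  ext W
  simp only [Set.mem_univ, Set.mem_setOf_eq, true_iff]
  exact ⟨funext fun i => Fin.elim0 i, fun b => Fin.elim0 b⟩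

/-- Finite intersections of EF'd sets (sizes add). [folklore] -/
theorem hasEFOfSize_biInter {ι : Type} [Fintype ι] {A : Type} (T : Finset A) (S : A → Set (ι → ℝ)) (r : A → ℕ)
    (h : ∀ a ∈ T, HasEFOfSize (S a) (r a)) : HasEFOfSize (⋂ a ∈ T, S a) (∑ a ∈ T, r a) := by
  classical
  induction T using Finset.induction_on with
  | empty => simpa using (hasEFOfSize_univ (ι := ι))
  | @insert a T ha ih =>
    rw [Finset.sum_insert ha, Finset.set_biInter_insert]
    exact hasEFOfSize_inter (h a (Finset.mem_insert_self a T))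
      (ih fun b hb => h b (Finset.mem_insert_of_mem hb))

/-- **Finite adaptability de-virtualizes additively**: if the passenger is covered by finitely many EF'd pieces
`Q = ⋃ₐ Qₐ` (`Qₐ` of size `sₐ`, nonempty) and every `x ∈ P` admits, for each piece, an AFFINE rule on that piece
(= a `|A|`-piece piecewise-affine rule subordinate to a FIXED cover), then `xc(P) ≤ Σₐ r·(sₐ+1)`
(`R ⊖ Q = ⋂ₐ R ⊖ Qₐ`, `hasEFOfSize_affineRuleSet` per piece, `hasEFOfSize_biInter`, bounded cancellation).
[folklore: finite adaptability, Bertsimas–Caramanis 2010, in EF currency] -/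
theorem finiteAdaptDeVirt {ι : Type} [Fintype ι] {r : ℕ} (RR : ExtendedFormulation ι r) {A : Type} [Fintype A]
    [Nonempty A] (s : A → ℕ) (QQ : ∀ a, ExtendedFormulation ι (s a)) (P Q : Set (ι → ℝ))
    (hPc : Convex ℝ P) (hPcl : IsClosed P) (hQ : Q = ⋃ a, (QQ a).projSet) (hne : ∀ a, (QQ a).projSet.Nonempty)
    (hbd : Bornology.IsBounded Q) (hRPQ : RR.projSet = P + Q) (hrule : ∀ a, ∀ x ∈ P, HasAffineRule RR (QQ a) x) :
    HasEFOfSize P (∑ a, r * (s a + 1)) := by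
  classical
  have h := hasEFOfSize_biInter (Finset.univ : Finset A) (fun a => {x | HasAffineRule RR (QQ a) x}) (fun a => r * (s a + 1))
    (fun a _ => hasEFOfSize_affineRuleSet RR (QQ a) (hne a))
  suffices hS : (⋂ a ∈ (Finset.univ : Finset A), {x | HasAffineRule RR (QQ a) x}) = P by rw [hS] at h; exact h
  ext x
  simp only [Finset.mem_univ, Set.iInter_true, Set.mem_iInter, Set.mem_setOf_eq]
  constructor
  · intro hx
    have hQne : Q.Nonempty := by
      obtain ⟨a⟩ := (inferInstance : Nonempty A)
      obtain ⟨u, hu⟩ := hne a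
      exact ⟨u, by rw [hQ]; exact Set.mem_iUnion.mpr ⟨a, hu⟩⟩
    refine mem_of_add_subset_add' hPc hPcl hbd hQne fun u hu => ?_
    rw [hQ] at hu
    obtain ⟨a, hua⟩ := Set.mem_iUnion.mp hu
    obtain ⟨y₀, Y, hY⟩ := hx a
    rw [← hRPQ]
    exact ⟨y₀ + Y *ᵥ u, (hY u hua).1, (hY u hua).2⟩
  · intro hx a
    exact hrule a x hx

end Summit.ValiantsHypothesis.ValiantsHypothesis.Cruxes.NNDivisionHard.VirtualXc
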